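import Summits.CriticalPhenomena.SAWScalingLimit.Theorems.SAWTotalPositivityCriticalBubbleBoundDockingFlip
import Summits.CriticalPhenomena.SAWScalingLimit.Theorems.SAWTotalPositivityCriticalBubbleBoundDockingTracks

/-!
# The docking injection `D_i ≤ x_c⁻¹ U_i` (line `docking-census-joining`, stub S1)

Crux `stmt-CriticalPhenomena-7117`
(`Summit.CriticalPhenomena.SAWScalingLimit.Theses.SAWTotalPositivity.CriticalBubbleBound`), line
`docking-census-joining`, registered stub `stub_dockingInjection` ("the docking injection"); objects
`dockings`, `pinches`, `dockMass`, `pinchMass` of `…Theorems.SAWTotalPositivityCriticalBubbleBoundDockingDefs`.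

**Statement.** `dockMass i ≤ x_c⁻¹ · pinchMass i` for every scale `i`, `x_c = criticalFugacity`.

**Proof.** A docking datum is `(j, k, ω, ω', v)` with `j, k ∈ B_i = [2^i, 2^{i+1})`,
`ω ∈ sawFun 2 j e₀`, `ω' ∈ sawFun 2 k e₀`, `v ∈ dockings j k ω ω'`: the rooted polygons
`P = pedges j ω ∋ rootEdge` and `P' = pedges k (shift v ω')` (root edge `{v, v+e₀}`) are
vertex-disjoint and a non-root horizontal edge `f` of `P` faces the root edge of `P'` across a unit
square with lower-left corner `q` (`q = v - e₁` if `f` lies below, `q = v` if `f` lies above).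
* `docking_image`: the plaquette flip (`exists_flip`) merges `P`, `P'` into one polygon `C ∋ rootEdge`
  with `j + k + 2` edges; opening it at the root (`exists_sawFun_of_isPolygon`) gives
  `χ ∈ sawFun 2 (j+k+1) e₀` with `pedges (j+k+1) χ = C`, `j+k+1 ∈ B_{i+1}`, and `q` is a macroscopic
  pinch plaquette of `χ` with witnesses `E₁ = P`, `E₂ = P'` (both have `≥ 2^i + 1` edges);
* `docking_unjoin`: the datum is recovered from `(χ, q)` — the inverse flip of `pedges χ` at `q` is
  `P ∪ P'`, whose rootEdge-component is `P` (`polygon_pair_unique`), so `ω` is determined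
  (`eq_of_pedges_shift_eq`); the lower side of the plaquette lies in `P` iff `q = v - e₁`, so `v`,
  `P'` and `ω'` are determined;
* `stub_dockingInjection`: both masses are finite sums over sigma-finsets; the map is a
  weight-preserving (`x_c^j x_c^k = x_c⁻¹ x_c^{j+k+1}`) injection into the index set of
  `x_c⁻¹ · pinchMass i`, whose terms are nonnegative.

Sources: A. Hammond, *An upper bound on the number of self-avoiding polygons via joining*, Ann.
Probab. 46 (2018), §4.1 (polygon joining at a plaquette); N. Madras, G. Slade, *The Self-Avoiding
Walk* (1993), §1.4, Definition 3.2.1.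
-/

noncomputable section

open Literature.Probability.LatticeModels
open Literature.Probability.RandomPlanarGeometry Literature.Probability.RandomPlanarGeometry.SAW
open scoped BigOperators
open Summit.CriticalPhenomena.SAWScalingLimit.Theorems.CriticalBubbleBound.Negative (e₀)

namespace Summit.CriticalPhenomena.SAWScalingLimit.Theorems.CriticalBubbleBound.Docking

/-! ## Unpacking a docking -/

/-- What a docking `v ∈ dockings j k ω ω'` (`j, k ∈ B_i`) provides: `j, k ≥ 2`; the rooted polygon
`P = pedges j ω` (through `rootEdge`, `j + 1` edges) and the translated partner
`P' = pedges k (shift v ω')` (through `{v, v+e₀}`, `k + 1` edges) are vertex-disjoint polygons;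
and a non-root horizontal edge of `P` lies just below or just above the partner's root.
[cite: MadrasSlade1993, Definition 3.2.1] -/
theorem docking_spec {i j k : ℕ} {ω ω' : ℕ → Site 2} {v : Site 2} (hj : j ∈ block i)
    (hk : k ∈ block i) (hω : ω ∈ Zd.sawFun 2 j e₀) (hω' : ω' ∈ Zd.sawFun 2 k e₀)
    (hv : v ∈ dockings j k ω ω') :
    2 ≤ j ∧ 2 ≤ k ∧
      IsPolygon (zdGraph 2) (pedges j ω) ∧ (pedges j ω).card = j + 1 ∧
      IsPolygon (zdGraph 2) (pedges k (shift v ω')) ∧ (pedges k (shift v ω')).card = k + 1 ∧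
      (∀ x, (∃ e ∈ pedges j ω, x ∈ e) → (∃ e ∈ pedges k (shift v ω'), x ∈ e) → False) ∧
      rootEdge ∈ pedges j ω ∧ s(v, v + e₀) ∈ pedges k (shift v ω') ∧
      ((s(v - e₁, v + e₀ - e₁) ∈ pedges j ω ∧ s(v - e₁, v + e₀ - e₁) ≠ rootEdge) ∨
        (s(v + e₁, v + e₀ + e₁) ∈ pedges j ω ∧ s(v + e₁, v + e₀ + e₁) ≠ rootEdge)) := by
  rw [dockings, Finset.mem_filter] at hv
  obtain ⟨-, hdisj, hcase⟩ := hv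
  have hj' := hj; have hk' := hk
  rw [block, Finset.mem_Ico] at hj' hk'
  have hj2 : 2 ≤ j := by
    rcases hcase with ⟨hf, hfr⟩ | ⟨hf, hfr⟩
    · exact two_le_of_mem_pedges hω hf hfr
    · exact two_le_of_mem_pedges hω hf hfr
  have hi : i ≠ 0 := by
    rintro rfl
    norm_num at hj'
    omega
  have hk2 : 2 ≤ k :=
    le_trans (by simpa using Nat.pow_le_pow_right (by norm_num : 0 < 2) (Nat.one_le_iff_ne_zero.2 hi))
      hk'.1
  have hP := pedges_shift_isPolygon hω hj2 0
  rw [shift_by_zero] at hP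
  refine ⟨hj2, hk2, hP.1, hP.2, (pedges_shift_isPolygon hω' hk2 v).1,
    (pedges_shift_isPolygon hω' hk2 v).2, fun x hx hx' => ?_, rootEdge_mem_pedges_of_mem_sawFun hω,
    root_shift_mem_pedges hω' v, hcase⟩
  rw [exists_mem_pedges_iff] at hx hx'
  exact Finset.disjoint_left.1 hdisj hx hx'

/-! ## The image of a docking: a rooted polygon of size `j + k + 1` with a macroscopic pinch -/

/-- **Joining.** For a docking datum with plaquette corner `q` (`q = v - e₁` when the facing edge of
`P` is the lower side `{q, q+e₀}`, `q = v` when it is the upper side `{q+e₁, q+e₀+e₁}`), the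
plaquette flip of `P ∪ P'` opened at the root edge is some `χ ∈ sawFun 2 (j+k+1) e₀` of which `q`
is a macroscopic pinch plaquette at scale `i`, and the inverse flip of `pedges (j+k+1) χ` at `q` is
`P ∪ P'`. [cite: MadrasSlade1993, Definition 3.2.1] -/
theorem docking_image {i j k : ℕ} {ω ω' : ℕ → Site 2} {v q : Site 2} (hj : j ∈ block i)
    (hk : k ∈ block i) (hω : ω ∈ Zd.sawFun 2 j e₀) (hω' : ω' ∈ Zd.sawFun 2 k e₀)
    (hv : v ∈ dockings j k ω ω')
    (hq : (q = v - e₁ ∧ s(q, q + e₀) ∈ pedges j ω ∧ s(q, q + e₀) ≠ rootEdge) ∨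
      (q = v ∧ s(q + e₁, q + e₀ + e₁) ∈ pedges j ω ∧ s(q + e₁, q + e₀ + e₁) ≠ rootEdge)) :
    ∃ χ ∈ Zd.sawFun 2 (j + k + 1) e₀, q ∈ pinches i (j + k + 1) χ ∧
      pedges j ω ∪ pedges k (shift v ω') = insert s(q, q + e₀) (insert s(q + e₁, q + e₀ + e₁)
        (((pedges (j + k + 1) χ).erase s(q, q + e₁)).erase s(q + e₀, q + e₀ + e₁))) := by
  obtain ⟨-, -, hP, hPc, hP', hP'c, hdis, hroot, hroot', -⟩ := docking_spec hj hk hω hω' hv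
  have hj' := hj; have hk' := hk
  rw [block, Finset.mem_Ico] at hj' hk'
  -- the flip data `(X, Y)`: `X` carries the lower side, `Y` the upper side of the plaquette
  have key : ∃ X Y : Finset (Sym2 (Site 2)), X ∪ Y = pedges j ω ∪ pedges k (shift v ω') ∧
      X.card + Y.card = j + k + 2 ∧ IsPolygon (zdGraph 2) X ∧ IsPolygon (zdGraph 2) Y ∧
      (∀ x, (∃ e ∈ X, x ∈ e) → (∃ e ∈ Y, x ∈ e) → False) ∧
      s(q, q + e₀) ∈ X ∧ s(q + e₁, q + e₀ + e₁) ∈ Y ∧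
      ((rootEdge ∈ X ∧ rootEdge ≠ s(q, q + e₀)) ∨
        (rootEdge ∈ Y ∧ rootEdge ≠ s(q + e₁, q + e₀ + e₁))) := by
    rcases hq with ⟨rfl, hf, hfr⟩ | ⟨rfl, hf, hfr⟩
    · refine ⟨_, _, rfl, by omega, hP, hP', hdis, hf, ?_, Or.inl ⟨hroot, hfr.symm⟩⟩
      have h1 : v - e₁ + e₁ = v := sub_add_cancel v e₁
      have h2 : v - e₁ + e₀ + e₁ = v + e₀ := by abel
      rw [h1, h2]
      exact hroot'
    · exact ⟨_, _, Finset.union_comm _ _, by omega, hP', hP, fun x h h' => hdis x h' h, hroot', hf,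
        Or.inr ⟨hroot, hfr.symm⟩⟩
  obtain ⟨X, Y, hU, hcard, hX, hY, hXY, hlo, hhi, hrXY⟩ := key
  obtain ⟨C, -, hC, hCc, hl, hr, hnlo, hnhi, hXC, hYC, hflip⟩ := exists_flip hX hY hXY hlo hhi
  have hrC : rootEdge ∈ C := by
    rcases hrXY with ⟨h, hne⟩ | ⟨h, hne⟩
    · exact hXC _ h hne
    · exact hYC _ h hne
  obtain ⟨χ, hχ, hχC⟩ := exists_sawFun_of_isPolygon hC hrC (n := j + k + 1) (by omega)
  refine ⟨χ, hχ, ?_, by rw [hχC, ← hflip, hU]⟩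
  classical
  rw [pinches, Finset.mem_filter]
  refine ⟨?_, ?_, ?_, ?_, ?_, pedges j ω, pedges k (shift v ω'), hP, hP', hdis, ?_, hroot, ?_, ?_⟩
  · rw [← exists_mem_pedges_iff, hχC]
    exact ⟨_, hl, Sym2.mem_mk_left _ _⟩
  · rw [hχC]; exact hl
  · rw [hχC]; exact hr
  · rw [hχC]; exact hnlo
  · rw [hχC]; exact hnhi
  · rw [hχC, ← hflip, hU]
  · rw [hPc]; exact Nat.succ_le_succ hj'.1
  · rw [hP'c]; exact Nat.succ_le_succ hk'.1

/-! ## The unjoin: the docking datum is determined by its image -/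

/-- **Unjoining (injectivity).** Two docking data at scale `i` with the same plaquette corner `q`
whose unflipped edge sets `P ∪ P'` agree are equal: the rootEdge-components agree
(`polygon_pair_unique`), hence the walks `ω`; the lower side of the plaquette lies in `P` exactly
in the case `q = v - e₁` (otherwise it is the partner's root, on the vertex-disjoint `P'`), hence the
translations `v` agree, hence the partners `ω'`. [cite: MadrasSlade1993, Definition 3.2.1] -/
theorem docking_unjoin {i j₁ k₁ j₂ k₂ : ℕ} {ω₁ ω₁' ω₂ ω₂' : ℕ → Site 2} {v₁ v₂ q : Site 2}
    (hj₁ : j₁ ∈ block i) (hk₁ : k₁ ∈ block i) (hω₁ : ω₁ ∈ Zd.sawFun 2 j₁ e₀)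
    (hω₁' : ω₁' ∈ Zd.sawFun 2 k₁ e₀) (hv₁ : v₁ ∈ dockings j₁ k₁ ω₁ ω₁')
    (hq₁ : (q = v₁ - e₁ ∧ s(q, q + e₀) ∈ pedges j₁ ω₁ ∧ s(q, q + e₀) ≠ rootEdge) ∨
      (q = v₁ ∧ s(q + e₁, q + e₀ + e₁) ∈ pedges j₁ ω₁ ∧ s(q + e₁, q + e₀ + e₁) ≠ rootEdge))
    (hj₂ : j₂ ∈ block i) (hk₂ : k₂ ∈ block i) (hω₂ : ω₂ ∈ Zd.sawFun 2 j₂ e₀)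
    (hω₂' : ω₂' ∈ Zd.sawFun 2 k₂ e₀) (hv₂ : v₂ ∈ dockings j₂ k₂ ω₂ ω₂')
    (hq₂ : (q = v₂ - e₁ ∧ s(q, q + e₀) ∈ pedges j₂ ω₂ ∧ s(q, q + e₀) ≠ rootEdge) ∨
      (q = v₂ ∧ s(q + e₁, q + e₀ + e₁) ∈ pedges j₂ ω₂ ∧ s(q + e₁, q + e₀ + e₁) ≠ rootEdge))
    (hU : pedges j₁ ω₁ ∪ pedges k₁ (shift v₁ ω₁') = pedges j₂ ω₂ ∪ pedges k₂ (shift v₂ ω₂')) :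
    j₁ = j₂ ∧ k₁ = k₂ ∧ ω₁ = ω₂ ∧ ω₁' = ω₂' ∧ v₁ = v₂ := by
  obtain ⟨hj2₁, hk2₁, hP₁, hP₁c, hP₁', hP₁'c, hdis₁, hroot₁, hroot₁', -⟩ :=
    docking_spec hj₁ hk₁ hω₁ hω₁' hv₁
  obtain ⟨-, -, hP₂, hP₂c, hP₂', hP₂'c, hdis₂, hroot₂, hroot₂', -⟩ :=
    docking_spec hj₂ hk₂ hω₂ hω₂' hv₂
  obtain ⟨hPP, hPP'⟩ := polygon_pair_unique hP₁ hP₂ hdis₁ hdis₂ hU hroot₁ hroot₂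
  have hj : j₁ = j₂ := by
    have := hP₁c
    rw [hPP, hP₂c] at this
    omega
  subst hj
  have hω : ω₁ = ω₂ :=
    eq_of_pedges_shift_eq hω₁ hω₂ hj2₁ (v := 0) (by rw [shift_by_zero, shift_by_zero]; exact hPP)
  subst hω
  have hv : v₁ = v₂ := by
    rcases hq₁ with ⟨h₁, hf₁, -⟩ | ⟨h₁, -, -⟩ <;> rcases hq₂ with ⟨h₂, hf₂, -⟩ | ⟨h₂, -, -⟩
    · exact sub_left_injective (h₁.symm.trans h₂)
    · -- lower side in `P₁ = P₂` and equal to the root of the partner `P₂'`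
      subst h₂
      exact (notMem_of_vertexDisjoint hdis₂ (hPP ▸ hf₁) hroot₂').elim
    · subst h₁
      exact (notMem_of_vertexDisjoint hdis₁ (hPP.symm ▸ hf₂) hroot₁').elim
    · exact h₁.symm.trans h₂
  subst hv
  have hk : k₁ = k₂ := by
    have := hP₁'c
    rw [hPP', hP₂'c] at this
    omega
  subst hk
  exact ⟨rfl, rfl, rfl, eq_of_pedges_shift_eq hω₁' hω₂' hk2₁ hPP', rfl⟩

/-! ## The docking injection -/

/-- **S1 `stub_dockingInjection` (the docking injection).** `dockMass i ≤ x_c⁻¹ · pinchMass i` for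
every `i`: the join `(j, k, ω, ω', v) ↦ (j+k+1, χ, q)` of `docking_image` maps the index set of the
finite sum `dockMass i` injectively (`docking_unjoin`) into the index set of `pinchMass i`, and
carries the weight `x_c^j x_c^k` to `x_c⁻¹ · x_c^{j+k+1}`; the remaining terms are nonnegative.
[cite: MadrasSlade1993, §1.4] -/
theorem stub_dockingInjection :
    ∀ i : ℕ, dockMass i ≤ criticalFugacity⁻¹ * pinchMass i := by
  intro i
  classical
  have hx0 : 0 < criticalFugacity := criticalFugacity_pos_lt_one'.1
  -- the two index finsets
  set T := ((block i ×ˢ block i).sigma fun jk : ℕ × ℕ =>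
      Zd.sawFun 2 jk.1 e₀ ×ˢ Zd.sawFun 2 jk.2 e₀).sigma
    fun p => dockings p.1.1 p.1.2 p.2.1 p.2.2 with hT
  set U := ((block (i + 1)).sigma fun n : ℕ => Zd.sawFun 2 n e₀).sigma
    fun p => pinches i p.1 p.2 with hU
  have hL : dockMass i = ∑ t ∈ T, criticalFugacity ^ t.1.1.1 * criticalFugacity ^ t.1.1.2 := by
    rw [dockMass, hT, Finset.sum_sigma, Finset.sum_sigma, Finset.sum_product]
    refine Finset.sum_congr rfl fun j _ => Finset.sum_congr rfl fun k _ => ?_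
    rw [Finset.sum_product]
    refine Finset.sum_congr rfl fun ω _ => Finset.sum_congr rfl fun ω' _ => ?_
    dsimp only
    rw [Finset.sum_const, nsmul_eq_mul]
  have hR : criticalFugacity⁻¹ * pinchMass i =
      ∑ u ∈ U, criticalFugacity⁻¹ * criticalFugacity ^ u.1.1 := by
    rw [pinchMass, hU, Finset.sum_sigma, Finset.sum_sigma, Finset.mul_sum]
    refine Finset.sum_congr rfl fun n _ => ?_
    rw [Finset.mul_sum]
    refine Finset.sum_congr rfl fun χ _ => ?_
    dsimp only
    rw [Finset.sum_const, nsmul_eq_mul]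
    ring
  -- the join, as a relation with an image for every docking datum
  have himg : ∀ t : (_ : (_ : ℕ × ℕ) × ((ℕ → Site 2) × (ℕ → Site 2))) × Site 2,
      ∃ u : (_ : (_ : ℕ) × (ℕ → Site 2)) × Site 2, t ∈ T →
        u ∈ U ∧ u.1.1 = t.1.1.1 + t.1.1.2 + 1 ∧
        ((u.2 = t.2 - e₁ ∧ s(u.2, u.2 + e₀) ∈ pedges t.1.1.1 t.1.2.1 ∧ s(u.2, u.2 + e₀) ≠ rootEdge) ∨
          (u.2 = t.2 ∧ s(u.2 + e₁, u.2 + e₀ + e₁) ∈ pedges t.1.1.1 t.1.2.1 ∧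
            s(u.2 + e₁, u.2 + e₀ + e₁) ≠ rootEdge)) ∧
        pedges t.1.1.1 t.1.2.1 ∪ pedges t.1.1.2 (shift t.2 t.1.2.2) =
          insert s(u.2, u.2 + e₀) (insert s(u.2 + e₁, u.2 + e₀ + e₁)
            (((pedges u.1.1 u.1.2).erase s(u.2, u.2 + e₁)).erase s(u.2 + e₀, u.2 + e₀ + e₁))) := by
    rintro ⟨⟨⟨j, k⟩, ω, ω'⟩, v⟩
    by_cases ht : (⟨⟨(j, k), (ω, ω')⟩, v⟩ : (_ : (_ : ℕ × ℕ) × ((ℕ → Site 2) × (ℕ → Site 2))) ×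
        Site 2) ∈ T
    · have ht' := ht
      simp only [hT, Finset.mem_sigma, Finset.mem_product] at ht'
      obtain ⟨⟨⟨hj, hk⟩, hω, hω'⟩, hv⟩ := ht'
      obtain ⟨-, -, -, -, -, -, -, -, -, hcase⟩ := docking_spec hj hk hω hω' hv
      -- the plaquette corner
      obtain ⟨q, hq⟩ : ∃ q : Site 2,
          (q = v - e₁ ∧ s(q, q + e₀) ∈ pedges j ω ∧ s(q, q + e₀) ≠ rootEdge) ∨
            (q = v ∧ s(q + e₁, q + e₀ + e₁) ∈ pedges j ω ∧ s(q + e₁, q + e₀ + e₁) ≠ rootEdge) := by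
        by_cases hA : s(v - e₁, v + e₀ - e₁) ∈ pedges j ω ∧ s(v - e₁, v + e₀ - e₁) ≠ rootEdge
        · refine ⟨v - e₁, Or.inl ⟨rfl, ?_⟩⟩
          have : v - e₁ + e₀ = v + e₀ - e₁ := by abel
          rw [this]
          exact hA
        · exact ⟨v, Or.inr ⟨rfl, hcase.resolve_left hA⟩⟩
      obtain ⟨χ, hχ, hpin, hunion⟩ := docking_image hj hk hω hω' hv hq
      have hj' := hj; have hk' := hk
      rw [block, Finset.mem_Ico] at hj' hk'
      refine ⟨⟨⟨j + k + 1, χ⟩, q⟩, fun _ => ⟨?_, rfl, hq, hunion⟩⟩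
      simp only [hU, Finset.mem_sigma]
      refine ⟨⟨?_, hχ⟩, hpin⟩
      rw [block, Finset.mem_Ico, pow_succ, pow_succ, pow_succ] at *
      generalize 2 ^ i = m at *
      omega
    · exact ⟨⟨⟨0, fun _ => 0⟩, 0⟩, fun h => (ht h).elim⟩
  choose Φ hΦ using himg
  -- injectivity
  have hinj : Set.InjOn Φ ↑T := by
    rintro ⟨⟨⟨j₁, k₁⟩, ω₁, ω₁'⟩, v₁⟩ ht₁ ⟨⟨⟨j₂, k₂⟩, ω₂, ω₂'⟩, v₂⟩ ht₂ heq
    rw [Finset.mem_coe] at ht₁ ht₂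
    obtain ⟨-, -, hq₁, hU₁⟩ := hΦ _ ht₁
    obtain ⟨-, -, hq₂, hU₂⟩ := hΦ _ ht₂
    rw [heq] at hq₁ hU₁
    simp only [hT, Finset.mem_sigma, Finset.mem_product] at ht₁ ht₂
    obtain ⟨⟨⟨hj₁, hk₁⟩, hω₁, hω₁'⟩, hv₁⟩ := ht₁
    obtain ⟨⟨⟨hj₂, hk₂⟩, hω₂, hω₂'⟩, hv₂⟩ := ht₂
    obtain ⟨rfl, rfl, rfl, rfl, rfl⟩ := docking_unjoin hj₁ hk₁ hω₁ hω₁' hv₁ hq₁ hj₂ hk₂ hω₂ hω₂'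
      hv₂ hq₂ (hU₁.trans hU₂.symm)
    rfl
  -- the estimate
  calc dockMass i = ∑ t ∈ T, criticalFugacity ^ t.1.1.1 * criticalFugacity ^ t.1.1.2 := hL
    _ = ∑ t ∈ T, criticalFugacity⁻¹ * criticalFugacity ^ (Φ t).1.1 := by
        refine Finset.sum_congr rfl fun t ht => ?_
        rw [(hΦ t ht).2.1, pow_succ, pow_add, eq_comm, inv_mul_eq_iff_eq_mul₀ hx0.ne']
        ring
    _ = ∑ u ∈ T.image Φ, criticalFugacity⁻¹ * criticalFugacity ^ u.1.1 :=
        (Finset.sum_image (f := fun u => criticalFugacity⁻¹ * criticalFugacity ^ u.1.1) hinj).symm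
    _ ≤ ∑ u ∈ U, criticalFugacity⁻¹ * criticalFugacity ^ u.1.1 := by
        refine Finset.sum_le_sum_of_subset_of_nonneg (Finset.image_subset_iff.2 fun t ht =>
          (hΦ t ht).1) fun u _ _ => ?_
        exact mul_nonneg (inv_nonneg.2 hx0.le) (pow_nonneg hx0.le _)
    _ = criticalFugacity⁻¹ * pinchMass i := hR.symm

end Summit.CriticalPhenomena.SAWScalingLimit.Theorems.CriticalBubbleBound.Docking

end
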